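import Summits.AtomisticToContinuum.FouriersLaw.Theorems.HiddenChargeMazurThomsonBoundGibbsCalculus

/-!
# Antisymmetry of the Liouville operator in `L²(e^{-H/T})` on the `e^{θH}` class (Thomson bound, part B)

Helper file (`--supports stmt-AtomisticToContinuum-13512`, decl `HiddenChargeMazur.ThomsonBound`).
For the pinned anharmonic chain `pinnedChain ω₂ lam β γ` (`ω₂ > 0`, `lam, β ≥ 0`), `T > 0`,
`ρ = e^{-H/T}` and `C¹` functions `u, v` with `|u|, |∂u|, |v|, |∂v| ≤ C e^{θH}`, `θ < 1/(2T)`: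
the Liouville operator `A = ∑_i (p_i ∂_{q_i} - ∂_{q_i}H ∂_{p_i})` (the Hamiltonian part of
`OscillatorChain.generator`) satisfies `∫ (A u) v ρ = -∫ u (A v) ρ`
(`integral_liouville_mul_eq_neg`; site by site `integral_liouvilleSite_mul_eq_neg`, two weighted
integrations by parts from part A whose `ρ'`-terms cancel).
[Bonetto–Lebowitz–Rey-Bellet 2000, §4.1; Cuneo–Eckmann–Hairer–Rey-Bellet 2018, §3.1]
-/

noncomputable section

open MeasureTheory

namespace Summit.AtomisticToContinuum.FouriersLaw.Theorems.ThomsonBound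

open Literature.MathematicalPhysics.KineticTheory.HeatConduction

variable {N : ℕ}

section Pinned

variable {ω₂ lam β : ℝ}

/-! ### Antisymmetry of the Liouville operator on the growth class -/

/-- `|w g| ≤ A C (1+H)^m e^{θH}` from `|w| ≤ A (1+H)^m`, `|g| ≤ C e^{θH}` (a weight times a class
member is a weighted class member). [folklore] -/
theorem abs_weight_mul_le {w g H A C θ : ℝ} {m : ℕ} (hw : |w| ≤ A * (1 + H) ^ m)
    (hg : |g| ≤ C * Real.exp (θ * H)) :
    |w * g| ≤ A * C * (1 + H) ^ m * Real.exp (θ * H) := by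
  rw [abs_mul]
  calc |w| * |g| ≤ (A * (1 + H) ^ m) * (C * Real.exp (θ * H)) :=
        mul_le_mul hw hg (abs_nonneg _) ((abs_nonneg _).trans hw)
    _ = A * C * (1 + H) ^ m * Real.exp (θ * H) := by ring

/-- **One site of the Liouville operator is antisymmetric in `L²(e^{-H/T})` on the growth class**:
`∫ (p_i ∂_{q_i}u - ∂_{q_i}H ∂_{p_i}u) v ρ = -∫ u (p_i ∂_{q_i}v - ∂_{q_i}H ∂_{p_i}v) ρ` for `C¹`
functions `u, v` with `|u|, |∂u|, |v|, |∂v| ≤ C e^{θH}`, `θ < 1/(2T)` (two weighted integrations by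
parts; the `ρ'`-terms `T⁻¹ ∫ p_i ∂_{q_i}H u v ρ` cancel). [folklore] -/
theorem integral_liouvilleSite_mul_eq_neg (hω : 0 < ω₂) (hl : 0 ≤ lam) (hβ : 0 ≤ β) (γ : ℝ)
    (N : ℕ) {T θ : ℝ} (hT : 0 < T) (hθ : θ < 1 / (2 * T)) {u v : PhaseSpace N → ℝ}
    (hu : ContDiff ℝ 1 u) (hv : ContDiff ℝ 1 v) {Cu Cv : ℝ}
    (hule : ∀ x, |u x| ≤ Cu * Real.exp (θ * (pinnedChain ω₂ lam β γ).hamiltonian N x))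
    (huq : ∀ x i, |partialQ i u x| ≤ Cu * Real.exp (θ * (pinnedChain ω₂ lam β γ).hamiltonian N x))
    (hup : ∀ x i, |partialP i u x| ≤ Cu * Real.exp (θ * (pinnedChain ω₂ lam β γ).hamiltonian N x))
    (hvle : ∀ x, |v x| ≤ Cv * Real.exp (θ * (pinnedChain ω₂ lam β γ).hamiltonian N x))
    (hvq : ∀ x i, |partialQ i v x| ≤ Cv * Real.exp (θ * (pinnedChain ω₂ lam β γ).hamiltonian N x))
    (hvp : ∀ x i, |partialP i v x| ≤ Cv * Real.exp (θ * (pinnedChain ω₂ lam β γ).hamiltonian N x))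
    (i : Fin N) :
    ∫ x, (x.2 i * partialQ i u x -
        partialQ i ((pinnedChain ω₂ lam β γ).hamiltonian N) x * partialP i u x) * v x *
        (pinnedChain ω₂ lam β γ).gibbsDensity N T x =
      -∫ x, u x * (x.2 i * partialQ i v x -
        partialQ i ((pinnedChain ω₂ lam β γ).hamiltonian N) x * partialP i v x) *
        (pinnedChain ω₂ lam β γ).gibbsDensity N T x := by
  set P := pinnedChain ω₂ lam β γ with hP
  set CN : ℝ := N * (ω₂ / 2 + 3 + lam / ω₂ + N ^ 2 * (3 + β)) with hCN
  have hH1 : ContDiff ℝ 1 (P.hamiltonian N) := pinnedChain_contDiff_hamiltonian ω₂ lam β γ N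
  have hHd : Differentiable ℝ (P.hamiltonian N) := hH1.differentiable one_ne_zero
  have hud : Differentiable ℝ u := hu.differentiable one_ne_zero
  have hvd : Differentiable ℝ v := hv.differentiable one_ne_zero
  have hWc : Continuous (partialQ i (P.hamiltonian N)) := P.continuous_partialQ_hamiltonian hH1 i
  have huQc : Continuous (partialQ i u) := continuous_partialQ hu one_ne_zero i
  have huPc : Continuous (partialP i u) := continuous_partialP hu one_ne_zero i
  have hvQc : Continuous (partialQ i v) := continuous_partialQ hv one_ne_zero i
  have hvPc : Continuous (partialP i v) := continuous_partialP hv one_ne_zero i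
  have hpi : ∀ x : PhaseSpace N, |x.2 i| ≤ 1 * (1 + P.hamiltonian N x) ^ 1 := fun x =>
    abs_momentum_le_one_add hl hβ γ N x i hω.le
  have hWle : ∀ x, |partialQ i (P.hamiltonian N) x| ≤ CN * (1 + P.hamiltonian N x) ^ 1 := fun x =>
    abs_partialQ_hamiltonian_le hω hl hβ γ N x i
  -- (E1): integration by parts in `q_i` with `a = p_i v`, `g = u`
  have E1 := integral_mul_lineDeriv_mul_gibbsDensity hω hl hβ γ N hT hθ
    (v := ((Pi.single i 1, 0) : PhaseSpace N)) (D := partialQ i (P.hamiltonian N))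
    (fun x => P.hasLineDerivAt_hamiltonian_unitQ hHd x i) hWc hWle
    (a := fun x => x.2 i * v x) (a' := fun x => x.2 i * partialQ i v x) (g := u)
    (g' := partialQ i u) (by fun_prop) ((by fun_prop : Continuous fun x : PhaseSpace N => x.2 i).mul hvQc)
    hu.continuous huQc
    (fun x => hasLineDerivAt_const_weight_mul (w := fun y : PhaseSpace N => y.2 i)
      (fun t => by simp) (hasLineDerivAt_partialQ hvd i x))
    (fun x => hasLineDerivAt_partialQ hud i x) (A := 1 * Cv) (C := Cu) (m := 1)
    (fun x => abs_weight_mul_le (hpi x) (hvle x)) (fun x => abs_weight_mul_le (hpi x) (hvq x i))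
    hule (fun x => huq x i)
  -- (E2): integration by parts in `p_i` with `a = ∂_{q_i}H v`, `g = u`
  have E2 := integral_mul_lineDeriv_mul_gibbsDensity hω hl hβ γ N hT hθ
    (v := ((0, Pi.single i 1) : PhaseSpace N)) (D := fun x => x.2 i)
    (fun x => P.hasLineDerivAt_hamiltonian_unitP N x i) (by fun_prop) hpi
    (a := fun x => partialQ i (P.hamiltonian N) x * v x)
    (a' := fun x => partialQ i (P.hamiltonian N) x * partialP i v x) (g := u)
    (g' := partialP i u) (hWc.mul hv.continuous) (hWc.mul hvPc) hu.continuous huPc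
    (fun x => hasLineDerivAt_const_weight_mul (w := partialQ i (P.hamiltonian N))
      (fun t => P.partialQ_hamiltonian_add_smul_unitP N x i i t) (hasLineDerivAt_partialP hvd i x))
    (fun x => hasLineDerivAt_partialP hud i x) (A := CN * Cv) (C := Cu) (m := 1)
    (fun x => abs_weight_mul_le (hWle x) (hvle x)) (fun x => abs_weight_mul_le (hWle x) (hvp x i))
    hule (fun x => hup x i)
  -- integrability of the four pieces (to split the integrals)
  have h2θ : 2 * θ < 1 / T := by
    have h := (lt_div_iff₀ (by positivity : (0:ℝ) < 2 * T)).mp hθ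
    rw [lt_div_iff₀ hT]; linarith
  have I1 : Integrable fun x => x.2 i * v x * partialQ i u x * P.gibbsDensity N T x :=
    integrable_mul_gibbsDensity_of_le_exp hω hl hβ γ N hT h2θ 1 ((by fun_prop : Continuous
      fun x : PhaseSpace N => x.2 i * v x).mul huQc)
      fun x => abs_mul_le_of_le_exp (abs_weight_mul_le (hpi x) (hvle x)) (huq x i)
  have I2 : Integrable fun x => partialQ i (P.hamiltonian N) x * v x * partialP i u x *
      P.gibbsDensity N T x :=
    integrable_mul_gibbsDensity_of_le_exp hω hl hβ γ N hT h2θ 1 ((hWc.mul hv.continuous).mul huPc)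
      fun x => abs_mul_le_of_le_exp (abs_weight_mul_le (hWle x) (hvle x)) (hup x i)
  have I3 : Integrable fun x => x.2 i * partialQ i v x * u x * P.gibbsDensity N T x :=
    integrable_mul_gibbsDensity_of_le_exp hω hl hβ γ N hT h2θ 1 (((by fun_prop : Continuous
      fun x : PhaseSpace N => x.2 i).mul hvQc).mul hu.continuous)
      fun x => abs_mul_le_of_le_exp (abs_weight_mul_le (hpi x) (hvq x i)) (hule x)
  have I4 : Integrable fun x => partialQ i (P.hamiltonian N) x * partialP i v x * u x *
      P.gibbsDensity N T x :=
    integrable_mul_gibbsDensity_of_le_exp hω hl hβ γ N hT h2θ 1 ((hWc.mul hvPc).mul hu.continuous)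
      fun x => abs_mul_le_of_le_exp (abs_weight_mul_le (hWle x) (hvp x i)) (hule x)
  -- the two `ρ'`-terms coincide
  have hX : ∫ x, partialQ i (P.hamiltonian N) x * (x.2 i * v x) * u x * P.gibbsDensity N T x =
      ∫ x, x.2 i * (partialQ i (P.hamiltonian N) x * v x) * u x * P.gibbsDensity N T x :=
    integral_congr_ae (Filter.Eventually.of_forall fun x => by simp only; ring)
  have lhs : ∫ x, (x.2 i * partialQ i u x - partialQ i (P.hamiltonian N) x * partialP i u x) * v x *
      P.gibbsDensity N T x =
      (∫ x, x.2 i * v x * partialQ i u x * P.gibbsDensity N T x) -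
        ∫ x, partialQ i (P.hamiltonian N) x * v x * partialP i u x * P.gibbsDensity N T x := by
    rw [← integral_sub I1 I2]
    refine integral_congr_ae (Filter.Eventually.of_forall fun x => ?_)
    simp only
    ring
  have rhs : ∫ x, u x * (x.2 i * partialQ i v x - partialQ i (P.hamiltonian N) x * partialP i v x) *
      P.gibbsDensity N T x =
      (∫ x, x.2 i * partialQ i v x * u x * P.gibbsDensity N T x) -
        ∫ x, partialQ i (P.hamiltonian N) x * partialP i v x * u x * P.gibbsDensity N T x := by
    rw [← integral_sub I3 I4]
    refine integral_congr_ae (Filter.Eventually.of_forall fun x => ?_)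
    simp only
    ring
  rw [lhs, rhs, E1, E2, hX]
  ring

/-- Each site term `(p_i ∂_{q_i}u - ∂_{q_i}H ∂_{p_i}u) v ρ` is integrable on the growth class.
[folklore] -/
theorem integrable_liouvilleSite_mul (hω : 0 < ω₂) (hl : 0 ≤ lam) (hβ : 0 ≤ β) (γ : ℝ)
    (N : ℕ) {T θ : ℝ} (hT : 0 < T) (hθ : θ < 1 / (2 * T)) {u v : PhaseSpace N → ℝ}
    (hu : ContDiff ℝ 1 u) (hv : Continuous v) {Cu Cv : ℝ}
    (huq : ∀ x i, |partialQ i u x| ≤ Cu * Real.exp (θ * (pinnedChain ω₂ lam β γ).hamiltonian N x))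
    (hup : ∀ x i, |partialP i u x| ≤ Cu * Real.exp (θ * (pinnedChain ω₂ lam β γ).hamiltonian N x))
    (hvle : ∀ x, |v x| ≤ Cv * Real.exp (θ * (pinnedChain ω₂ lam β γ).hamiltonian N x))
    (i : Fin N) :
    Integrable fun x => (x.2 i * partialQ i u x -
        partialQ i ((pinnedChain ω₂ lam β γ).hamiltonian N) x * partialP i u x) * v x *
        (pinnedChain ω₂ lam β γ).gibbsDensity N T x := by
  set P := pinnedChain ω₂ lam β γ with hP
  set CN : ℝ := N * (ω₂ / 2 + 3 + lam / ω₂ + N ^ 2 * (3 + β)) with hCN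
  have hH1 : ContDiff ℝ 1 (P.hamiltonian N) := pinnedChain_contDiff_hamiltonian ω₂ lam β γ N
  have hWc : Continuous (partialQ i (P.hamiltonian N)) := P.continuous_partialQ_hamiltonian hH1 i
  have huQc : Continuous (partialQ i u) := continuous_partialQ hu one_ne_zero i
  have huPc : Continuous (partialP i u) := continuous_partialP hu one_ne_zero i
  have hpi : ∀ x : PhaseSpace N, |x.2 i| ≤ 1 * (1 + P.hamiltonian N x) ^ 1 := fun x =>
    abs_momentum_le_one_add hl hβ γ N x i hω.le
  have hWle : ∀ x, |partialQ i (P.hamiltonian N) x| ≤ CN * (1 + P.hamiltonian N x) ^ 1 := fun x =>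
    abs_partialQ_hamiltonian_le hω hl hβ γ N x i
  have h2θ : 2 * θ < 1 / T := by
    have h := (lt_div_iff₀ (by positivity : (0:ℝ) < 2 * T)).mp hθ
    rw [lt_div_iff₀ hT]; linarith
  have I1 : Integrable fun x => x.2 i * partialQ i u x * v x * P.gibbsDensity N T x :=
    integrable_mul_gibbsDensity_of_le_exp hω hl hβ γ N hT h2θ 1 (((by fun_prop : Continuous
      fun x : PhaseSpace N => x.2 i).mul huQc).mul hv)
      fun x => abs_mul_le_of_le_exp (abs_weight_mul_le (hpi x) (huq x i)) (hvle x)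
  have I2 : Integrable fun x => partialQ i (P.hamiltonian N) x * partialP i u x * v x *
      P.gibbsDensity N T x :=
    integrable_mul_gibbsDensity_of_le_exp hω hl hβ γ N hT h2θ 1 ((hWc.mul huPc).mul hv)
      fun x => abs_mul_le_of_le_exp (abs_weight_mul_le (hWle x) (hup x i)) (hvle x)
  refine (I1.sub I2).congr (Filter.Eventually.of_forall fun x => ?_)
  simp only [Pi.sub_apply]
  ring

/-- **Antisymmetry of the Liouville operator** `A = ∑_i (p_i ∂_{q_i} - ∂_{q_i}H ∂_{p_i})` in
`L²(e^{-H/T} dq dp)` on the growth class: `∫ (A u) v ρ = -∫ u (A v) ρ`.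
[Bonetto–Lebowitz–Rey-Bellet 2000, §4.1; Cuneo–Eckmann–Hairer–Rey-Bellet 2018, §3.1] [folklore] -/
theorem integral_liouville_mul_eq_neg (hω : 0 < ω₂) (hl : 0 ≤ lam) (hβ : 0 ≤ β) (γ : ℝ)
    (N : ℕ) {T θ : ℝ} (hT : 0 < T) (hθ : θ < 1 / (2 * T)) {u v : PhaseSpace N → ℝ}
    (hu : ContDiff ℝ 1 u) (hv : ContDiff ℝ 1 v) {Cu Cv : ℝ}
    (hule : ∀ x, |u x| ≤ Cu * Real.exp (θ * (pinnedChain ω₂ lam β γ).hamiltonian N x))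
    (huq : ∀ x i, |partialQ i u x| ≤ Cu * Real.exp (θ * (pinnedChain ω₂ lam β γ).hamiltonian N x))
    (hup : ∀ x i, |partialP i u x| ≤ Cu * Real.exp (θ * (pinnedChain ω₂ lam β γ).hamiltonian N x))
    (hvle : ∀ x, |v x| ≤ Cv * Real.exp (θ * (pinnedChain ω₂ lam β γ).hamiltonian N x))
    (hvq : ∀ x i, |partialQ i v x| ≤ Cv * Real.exp (θ * (pinnedChain ω₂ lam β γ).hamiltonian N x))
    (hvp : ∀ x i, |partialP i v x| ≤ Cv * Real.exp (θ * (pinnedChain ω₂ lam β γ).hamiltonian N x)) :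
    ∫ x, (∑ i, (x.2 i * partialQ i u x -
        partialQ i ((pinnedChain ω₂ lam β γ).hamiltonian N) x * partialP i u x)) * v x *
        (pinnedChain ω₂ lam β γ).gibbsDensity N T x =
      -∫ x, u x * (∑ i, (x.2 i * partialQ i v x -
        partialQ i ((pinnedChain ω₂ lam β γ).hamiltonian N) x * partialP i v x)) *
        (pinnedChain ω₂ lam β γ).gibbsDensity N T x := by
  set P := pinnedChain ω₂ lam β γ with hP
  have Iu := integrable_liouvilleSite_mul hω hl hβ γ N hT hθ hu hv.continuous huq hup hvle
  have Iv := integrable_liouvilleSite_mul hω hl hβ γ N hT hθ hv hu.continuous hvq hvp hule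
  have lhs : ∫ x, (∑ i, (x.2 i * partialQ i u x - partialQ i (P.hamiltonian N) x * partialP i u x)) *
      v x * P.gibbsDensity N T x =
      ∑ i, ∫ x, (x.2 i * partialQ i u x - partialQ i (P.hamiltonian N) x * partialP i u x) * v x *
        P.gibbsDensity N T x := by
    rw [← integral_finsetSum _ fun i _ => Iu i]
    refine integral_congr_ae (Filter.Eventually.of_forall fun x => ?_)
    simp only [Finset.sum_mul]
    rfl
  have rhs : ∫ x, u x * (∑ i, (x.2 i * partialQ i v x - partialQ i (P.hamiltonian N) x *
      partialP i v x)) * P.gibbsDensity N T x =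
      ∑ i, ∫ x, (x.2 i * partialQ i v x - partialQ i (P.hamiltonian N) x * partialP i v x) * u x *
        P.gibbsDensity N T x := by
    rw [← integral_finsetSum _ fun i _ => Iv i]
    refine integral_congr_ae (Filter.Eventually.of_forall fun x => ?_)
    simp only [Finset.mul_sum, Finset.sum_mul]
    exact Finset.sum_congr rfl fun i _ => by ring
  rw [lhs, rhs, ← Finset.sum_neg_distrib]
  refine Finset.sum_congr rfl fun i _ => ?_
  rw [integral_liouvilleSite_mul_eq_neg hω hl hβ γ N hT hθ hu hv hule huq hup hvle hvq hvp i]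
  congr 1
  exact integral_congr_ae (Filter.Eventually.of_forall fun x => by simp only; ring)

end Pinned

end Summit.AtomisticToContinuum.FouriersLaw.Theorems.ThomsonBound

end
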